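import Summits.ValiantsHypothesis.ValiantsHypothesis.Theorems.DivisionGapPerDivisionHardStubRectKill
import Summits.ValiantsHypothesis.ValiantsHypothesis.Theorems.DivisionGapDefs
import Summits.ValiantsHypothesis.ValiantsHypothesis.Theorems.DivisionGapPerDivisionHardStubDescentAt
import Summits.ValiantsHypothesis.ValiantsHypothesis.Theorems.DivisionGapPerDivisionHardStubFibreArith
import Summits.ValiantsHypothesis.ValiantsHypothesis.Theorems.DivisionGapPerDivisionHardStubBlockArsenal

/-!
# Crux `DivisionGap.PerDivisionHard` (stmt-ValiantsHypothesis-5065), line `pair-descent-jss-endpoint` —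
the DEFICIENCY rung, unconditionally: a monomial with a polylogarithmic Hall violator makes `per_n · h` expensive

`PerDivisionHard` asks: for every `c`, for all large `n`, every nonzero `h ∈ ℝ≥0[x_ij]` has
`2^{(log₂ n + c)^c} < L(per_n · h) + L(h)`.  This file proves it for every HOMOGENEOUS (in particular every
torus-homogeneous) cofactor `h` having a monomial `u` that vanishes on a rectangle `A × B` (rows `A`,
columns `B`) with `|A| + |B| ≥ n + (log₂ n + c')^{c'}` — equivalently (König–Hall) a monomial whose
support, read as a bipartite graph, has maximum matching at most `n - (log₂ n + c')^{c'}`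
(`perDivisionHard_deficient`, `perDivisionHard_deficientTorus`; `c' = c'(c)`).  It contains the low-degree
rung (`deg h ≤ n - polylog`: every monomial misses that many rows; `B =` all columns) and the rows-avoided
rung, and needs no gadget and no placement search.

Mechanism (the rectangle face of the erasure principle, skeleton v11): under the weight `𝟙` off `A × B`
the top fibre of `h` is the set of its monomials AVOIDING the rectangle and the top of `per_n` is the set of
permutations meeting it in exactly `j = |A| + |B| - n` cells; substituting `1` off the rectangle kills the
fibre to a positive constant, and zeroing `A × B` down to a `j × j` block leaves a polynomial with the
support of `per_j`, which costs `≥ 2^{j/3}` (Jerrum–Snir by support).  All of this is the landed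
`stub_rectKill`; here only the composition with `complexity_topComponent_le`.
-/

noncomputable section

-- `Summit.ValiantsHypothesis.ValiantsHypothesis.…` is the tree's mandated single-conjunct layout
-- (Sub = Summit), so the duplicated namespace component is intended.
set_option linter.dupNamespace false

namespace Summit.ValiantsHypothesis.ValiantsHypothesis.Theorems.DivisionGapPerDivisionHard

open MvPolynomial Literature.Computability.AlgebraicComplexity
open Summit.ValiantsHypothesis.ValiantsHypothesis.Theorems.ZeroOneTransfer.Negative
open scoped NNReal

/-- Torus-homogeneous polynomials are homogeneous: all monomials share the row margins `r`, hence the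
total degree `|r|`. [folklore] -/
theorem isHomogeneous_of_isTorusHomogeneous' {n : ℕ} {h : MvPolynomial (Fin n × Fin n) ℝ≥0}
    (htor : IsTorusHomogeneous h) : ∃ d, h.IsHomogeneous d := by
  classical
  obtain ⟨r, c, hrc⟩ := htor
  refine ⟨r.degree, ?_⟩
  rw [MvPolynomial.IsHomogeneous, MvPolynomial.IsWeightedHomogeneous]
  intro m hm
  have hmem : m ∈ h.support := by simpa [MvPolynomial.mem_support_iff] using hm
  have hr := (hrc m hmem).1
  have e1 : Finsupp.weight (1 : Fin n × Fin n → ℕ) m = m.degree := by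
    rw [Finsupp.degree_eq_weight_one]; rfl
  rw [e1, ← Finsupp.degree_mapDomain Prod.fst m]
  show (Finsupp.mapDomain Prod.fst m).degree = r.degree
  rw [← hr]; rfl

/-- **The deficiency rung of `PerDivisionHard`, unconditionally.**  For every `c` there are `c', n₀`
such that for `n ≥ n₀`: every nonzero homogeneous `h ∈ ℝ≥0[x_ij]` with a monomial vanishing on a rectangle
`A × B` (rows `A`, columns `B`), `|A| + |B| ≥ n + (log₂ n + c')^{c'}`, satisfies
`2^{(log₂ n + c)^c} < L(per_n · h) + L(h)` (indeed `< L(per_n · h)`). [folklore] -/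
theorem perDivisionHard_deficient :
    ∀ c : ℕ, ∃ c' n₀ : ℕ, ∀ n ≥ n₀, ∀ (h : MvPolynomial (Fin n × Fin n) ℝ≥0) (d : ℕ),
      h ≠ 0 → h.IsHomogeneous d →
      (∃ u ∈ h.support, ∃ A B : Finset (Fin n),
        (∀ e : Fin n × Fin n, e.1 ∈ A → e.2 ∈ B → u e = 0) ∧
        n + (Nat.log 2 n + c') ^ c' ≤ A.card + B.card) →
      2 ^ ((Nat.log 2 n + c) ^ c) < complexity (perPoly (Fin n) ℝ≥0 * h) + complexity h := by
  intro c
  obtain ⟨c', n₀, hK⟩ := stub_rectKill c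
  refine ⟨c', n₀, fun n hn h d _ hhom ⟨u, hu, A, B, hrect, hAB⟩ => ?_⟩
  have h1 := hK n hn A B h d u hhom hu hrect hAB
  have h2 := complexity_topComponent_le
    (fun e : Fin n × Fin n => if e.1 ∈ A ∧ e.2 ∈ B then 0 else 1) (perPoly (Fin n) ℝ≥0 * h)
  omega

/-- **The deficiency rung for torus-homogeneous cofactors** (the form produced by the line's torus
step `stub_torus`). [folklore] -/
theorem perDivisionHard_deficientTorus :
    ∀ c : ℕ, ∃ c' n₀ : ℕ, ∀ n ≥ n₀, ∀ h : MvPolynomial (Fin n × Fin n) ℝ≥0,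
      h ≠ 0 → IsTorusHomogeneous h →
      (∃ u ∈ h.support, ∃ A B : Finset (Fin n),
        (∀ e : Fin n × Fin n, e.1 ∈ A → e.2 ∈ B → u e = 0) ∧
        n + (Nat.log 2 n + c') ^ c' ≤ A.card + B.card) →
      2 ^ ((Nat.log 2 n + c) ^ c) < complexity (perPoly (Fin n) ℝ≥0 * h) + complexity h := by
  intro c
  obtain ⟨c', n₀, hK⟩ := perDivisionHard_deficient c
  refine ⟨c', n₀, fun n hn h hh htor hdef => ?_⟩
  obtain ⟨d, hd⟩ := isHomogeneous_of_isTorusHomogeneous' htor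
  exact hK n hn h d hh hd hdef

/-- **The deficiency rung through the top homogeneous component** (arbitrary nonzero `h`): it suffices
that a monomial of MAXIMAL total degree vanishes on the rectangle — the top homogeneous component is free
(`complexity_topComponent_le` with the constant weight) and `per_n` is homogeneous. [folklore] -/
theorem perDivisionHard_deficientTop :
    ∀ c : ℕ, ∃ c' n₀ : ℕ, ∀ n ≥ n₀, ∀ h : MvPolynomial (Fin n × Fin n) ℝ≥0, h ≠ 0 →
      (∃ u ∈ h.support, (∀ v ∈ h.support, v.degree ≤ u.degree) ∧ ∃ A B : Finset (Fin n),
        (∀ e : Fin n × Fin n, e.1 ∈ A → e.2 ∈ B → u e = 0) ∧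
        n + (Nat.log 2 n + c') ^ c' ≤ A.card + B.card) →
      2 ^ ((Nat.log 2 n + c) ^ c) < complexity (perPoly (Fin n) ℝ≥0 * h) + complexity h := by
  intro c
  obtain ⟨c', n₀, hK⟩ := perDivisionHard_deficient c
  refine ⟨c', n₀, fun n hn h hh ⟨u, hu, hmax, A, B, hrect, hAB⟩ => ?_⟩
  classical
  -- the top homogeneous component `h₁ = top_{𝟙} h` contains `u` and is homogeneous of degree `deg u`
  set w₁ : Fin n × Fin n → ℕ := fun _ => 1 with hw₁
  set h₁ := topComponent w₁ h with hh₁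
  have hwdeg : ∀ v : (Fin n × Fin n) →₀ ℕ, Finsupp.weight w₁ v = v.degree := fun v => by
    rw [Finsupp.degree_eq_weight_one]
  have hW : weightedTotalDegree w₁ h = u.degree := by
    apply le_antisymm
    · rw [weightedTotalDegree]
      exact Finset.sup_le fun v hv => by rw [hwdeg]; exact hmax v hv
    · rw [← hwdeg]; exact le_weightedTotalDegree w₁ hu
  have hu₁ : u ∈ h₁.support := by
    rw [MvPolynomial.mem_support_iff, hh₁, coeff_topComponent, if_pos (by rw [hW, hwdeg])]
    exact MvPolynomial.mem_support_iff.mp hu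
  have hne₁ : h₁ ≠ 0 := topComponent_ne_zero w₁ hh
  have hhom₁ : h₁.IsHomogeneous u.degree := by
    rw [MvPolynomial.IsHomogeneous, MvPolynomial.IsWeightedHomogeneous]
    intro v hv
    have hv' : v ∈ h₁.support := MvPolynomial.mem_support_iff.mpr hv
    rw [hh₁, MvPolynomial.mem_support_iff, coeff_topComponent] at hv'
    split_ifs at hv' with hvw
    · rw [hW] at hvw
      have : Finsupp.weight (1 : Fin n × Fin n → ℕ) v = Finsupp.weight w₁ v := rfl
      rw [this, hvw]
    · exact absurd rfl hv'
  -- the rung for `h₁`, then `L(per · h₁) ≤ L(per · h)` and `L(h₁) ≤ L(h)`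
  have hmain := hK n hn h₁ u.degree hne₁ hhom₁ ⟨u, hu₁, A, B, hrect, hAB⟩
  have hper : topComponent w₁ (perPoly (Fin n) ℝ≥0) = perPoly (Fin n) ℝ≥0 := by
    refine topComponent_eq_self_of_isWeightedHomogeneous w₁ (n := Fintype.card (Fin n)) ?_
    exact perPoly_isHomogeneous (n := Fin n) (k := ℝ≥0)
  have hle1 : complexity (perPoly (Fin n) ℝ≥0 * h₁) ≤ complexity (perPoly (Fin n) ℝ≥0 * h) := by
    have := complexity_topComponent_le w₁ (perPoly (Fin n) ℝ≥0 * h)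
    rwa [topComponent_mul, hper] at this
  have hle2 : complexity h₁ ≤ complexity h := complexity_topComponent_le w₁ h
  omega

/-- **The deficiency rung ACROSS SCALES** (through the line's generic descent transfer): it suffices
that on SOME placed block face `G(b,k) ⊕ M₀` with `n ≤ b^a`, under SOME weight cutting it out, the
projected cofactor `h♭ = aeval (blockSubst eR eC) (top_w h)` (a cofactor of `per_b`: landed
`stub_descentAt`) has a monomial of maximal degree vanishing on a rectangle of the `b × b` block of
deficiency `≥ (log₂ b + c')^{c'}`. [folklore] -/
theorem perDivisionHard_deficientFibre :
    ∀ a c : ℕ, ∃ c' n₀ : ℕ, ∀ n ≥ n₀, ∀ h : MvPolynomial (Fin n × Fin n) ℝ≥0, h ≠ 0 →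
      (∃ (b k m : ℕ) (eR eC : BlockV b k m ≃ Fin n) (w : Fin n × Fin n → ℕ),
        CutsOut w (placedBlock eR eC) ∧ n ≤ b ^ a ∧
        ∃ u ∈ (aeval (blockSubst eR eC) (topComponent w h)).support,
          (∀ v ∈ (aeval (blockSubst eR eC) (topComponent w h)).support, v.degree ≤ u.degree) ∧
          ∃ A B : Finset (Fin b), (∀ e : Fin b × Fin b, e.1 ∈ A → e.2 ∈ B → u e = 0) ∧
            b + (Nat.log 2 b + c') ^ c' ≤ A.card + B.card) →
      2 ^ ((Nat.log 2 n + c) ^ c) < complexity (perPoly (Fin n) ℝ≥0 * h) + complexity h := by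
  intro a c
  obtain ⟨c₁, hc₁⟩ := stub_fibreArith a c
  obtain ⟨c', n₁, hK⟩ := perDivisionHard_deficientTop c₁
  refine ⟨c', n₁ ^ a + 2, ?_⟩
  rintro n hn h hh ⟨b, k, m, eR, eC, w, hcut, hnb, hdef⟩
  have ha : a ≠ 0 := by
    rintro rfl
    rw [pow_zero] at hnb
    omega
  have hb : n₁ ≤ b := by
    by_contra hlt
    have hlt' : b < n₁ := not_le.mp hlt
    have : b ^ a < n₁ ^ a := Nat.pow_lt_pow_left hlt' ha
    omega
  obtain ⟨hne, hle1, hle2, -⟩ := stub_descentAt b k m n eR eC w h hcut hh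
  have hmain := hK b hb _ hne hdef
  calc 2 ^ ((Nat.log 2 n + c) ^ c) ≤ 2 ^ ((Nat.log 2 b + c₁) ^ c₁) :=
        Nat.pow_le_pow_right two_pos (hc₁ n b hnb)
    _ < _ := hmain
    _ ≤ complexity (perPoly (Fin n) ℝ≥0 * h) + complexity h := Nat.add_le_add hle1 hle2

end Summit.ValiantsHypothesis.ValiantsHypothesis.Theorems.DivisionGapPerDivisionHard

end
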